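import Summits.CriticalPhenomena.PercolationContinuityZ3.Theorems.Transplant.SkelPhiStepI
import Summits.CriticalPhenomena.PercolationContinuityZ3.Theorems.Transplant.PlanarSkeletonNegSlabs
import Summits.CriticalPhenomena.PercolationContinuityZ3.Theorems.Transplant.PlanarSkeletonSignDefs
import HarnessLib

/-!
# D″ node, the STEP I′ INSTANCE over `PlanarSkeletonSign` (V98: "LEVEL 0 over Sign" — the plumbing): every hypothesis of the φ-level
# `Skelφ.exists_stepI` is a field of the structure or a landed theorem — `Lip/Steps/CylConn/Frames` (fields), `NegAt/FlipAt` (`neg`, `flip`),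
# `SlabInputs` (p5's `slab_F1_inputs`, subexponential branch), a.s. uniqueness at `p` (Burton–Keane on the connected, quasi-transitive, amenable
# skeleton graph), `0 < p` from `θ_z(p) > 0` — so Step I′ of route D″ v2 holds for every `PlanarSkeletonSign` graph of subexponential growth at
# every density with `θ > 0` and Φ2

builds on p205010 (kernel theorem, internal audit signed; external expert review pending) — nothing in this file uses p205010.
Lane `prim-bschramm`, seat `prim-bschramm-p3` (gen 7; D″ design owner); helper file (`--supports stmt-CriticalPhenomena-4575`).
* `negAt`, `flipAt` (dictionary forms of the fields), `slabInputs` (from `slab_F1_inputs`), `numInfiniteClusters_le_one` (Burton–Keane),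
  `pos_of_theta_pos`, **`exists_stepI`** (Step I′ for `Φ : PlanarSkeletonSign G`, `¬ HasExponentialGrowth G`, `θ_z(p) > 0`, Φ2 at `p`).
[cite: KozmaNitzan2024, §4 p. 17 (Step I)] [cite: LyonsPeres2016, Thm. 7.6 (Burton–Keane)] [cite: GrimmettPercolation1999, §7.3]
-/

noncomputable section

open MeasureTheory

namespace Summit.CriticalPhenomena.PercolationContinuityZ3.Theorems.Transplant

namespace PlanarSkeletonSign

open Literature.Probability.Percolation Literature.Probability.LatticeModels SimpleGraph
open Literature.Barriers.CriticalPhenomena (IsQuasiTransitive IsGraphAmenable HasExponentialGrowth hasExponentialGrowth_of_not_isGraphAmenable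
  BurtonKeane1989_atMostOneInfiniteCluster_holds)
open scoped Classical

variable {V : Type} [DecidableEq V] [Countable V] {G : SimpleGraph V} [G.LocallyFinite] (Φ : PlanarSkeletonSign G)

omit [DecidableEq V] [Countable V] in
/-- The central inversion field in dictionary form. [folklore] -/
theorem negAt {t : V} (ht : t ∈ Φ.types) : Skelφ.NegAt G Φ.φ t := Φ.neg t ht

omit [DecidableEq V] [Countable V] in
/-- The flip field in dictionary form. [folklore] -/
theorem flipAt {t : V} (ht : t ∈ Φ.types) : Skelφ.FlipAt G Φ.φ t := Φ.flip t ht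

omit [Countable V] in
/-- **The (F1) slab inputs of a `PlanarSkeletonSign` of subexponential growth** (p5's `slab_F1_inputs`, both axes, every base vertex, every width `≥ 1`).
[cite: LyonsPeres2016, Thm. 7.5–7.6 (method)] -/
theorem slabInputs (hG : ¬ HasExponentialGrowth G) (p : unitInterval) : Skelφ.SlabInputs G Φ.φ Φ.types p :=
  fun t _ i e he => Φ.toPlanarSkeletonNeg.slab_F1_inputs hG t i p he e le_rfl

omit [Countable V] in
/-- **A.s. uniqueness at every density** on a `PlanarSkeletonSign` graph of subexponential growth (connected by (ι)+(κ), quasi-transitive by the frames,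
amenable by the growth hypothesis; Burton–Keane). [cite: LyonsPeres2016, Thm. 7.6] -/
theorem numInfiniteClusters_le_one (hG : ¬ HasExponentialGrowth G) {t : V} (ht : t ∈ Φ.types) (p : unitInterval) :
    ∀ᵐ ω ∂(bondPercolation G p), numInfiniteClusters ω ≤ 1 := by
  have hq : IsQuasiTransitive G := Φ.toPlanarSkeletonNeg.isQuasiTransitive
  have ha : IsGraphAmenable G := by_contra fun hna => hG (hasExponentialGrowth_of_not_isGraphAmenable G hq hna)
  have _ := ht
  exact BurtonKeane1989_atMostOneInfiniteCluster_holds G (Φ.toPlanarSkeletonNeg.graph_connected t) hq ha p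

omit [DecidableEq V] [G.LocallyFinite] in
/-- `θ_z(p) > 0` forces `p > 0` (at `p = 0` nothing percolates: `theta_bot`). [folklore] -/
theorem pos_of_theta_pos {z : V} {p : unitInterval} (hθ : 0 < theta G z p) : 0 < (p : ℝ) := by
  rcases p.2.1.lt_or_eq with h | h
  · exact h
  · exfalso
    have hp : p = 0 := Subtype.ext h.symm
    rw [hp] at hθ
    exact hθ.ne' (theta_bot G z)

/-- **STEP I′ OF ROUTE D″ v2 ON A `PlanarSkeletonSign` GRAPH** of subexponential growth, at every density `p` with `θ_z(p) > 0` somewhere and Φ2 at `p`: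
the packaged Step-I′ data of `Skelφ.exists_stepI` with every dictionary hypothesis discharged from the structure. [cite: KozmaNitzan2024, §4 p. 17 (Step I)] -/
theorem exists_stepI (hG : ¬ HasExponentialGrowth G) {p : unitInterval} (hC : Φ.CylSubcritical p) {z : V} (hθ : 0 < theta G z p)
    {t₀ : V} (ht₀ : t₀ ∈ Φ.types) {δ : ℝ} (hδ : 0 < δ) (m₀ : ℕ) :
    ∃ (D : Skelφ.StepI.Data V) (off M₀ n₁ : ℕ), m₀ ≤ D.k ∧ 1 ≤ D.k ∧ D.R = Skelφ.fatRadius Φ.frame hC ∧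
      D.Λ = Skelφ.fatSeqOff Φ.frame hC off ∧ D.k < M₀ ∧ D.k < n₁ ∧ (∀ ℓ, D.k ≤ D.Gb ℓ ∧ D.k ≤ D.Fb ℓ) ∧
      ∀ Sz Sx Sy : Finset ℕ, (∀ M ∈ Sz, M₀ ≤ M) → (∀ ℓ ∈ Sx, n₁ ≤ ℓ) → (∀ ℓ ∈ Sy, n₁ ≤ ℓ) →
        ∀ i ∈ Skelφ.StepI.index Φ.types Sz Sx Sy, 1 - δ < (bondPercolation G p).real (Skelφ.StepI.event G Φ.φ D i) :=
  Skelφ.exists_stepI (hfr := Φ.frame) (hC := hC) Φ.lip Φ.step Φ.cyl_connected (pos_of_theta_pos hθ) (Φ.slabInputs hG p) hθ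
    (Φ.numInfiniteClusters_le_one hG ht₀ p) (fun _ ht => Φ.negAt ht) (fun _ ht => Φ.flipAt ht) hδ m₀

end PlanarSkeletonSign

end Summit.CriticalPhenomena.PercolationContinuityZ3.Theorems.Transplant

end
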